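import Mathlib
import Summits.CriticalPhenomena.PercolationContinuityZ3.Theorems.PercNearOneGluingNoHeavyLowerTailOddsBernstein
import HarnessLib

/-!
# CONJECTURE A′: sharpness of the threshold `θ + γ = 1`, and the W♯ kernel form with dilation

Support file for the Sahi / Conjecture-P programme of route `PercNearOneGluingNoHeavy`
(`--supports stmt-CriticalPhenomena-4575`, prover prim-l12-p5 gen 37; proof note
`prim-l12-p5/PROOF-ODDS-BERNSTEIN-g37.md` §2–§3).  No definitions, no named facts, no sorries.  Companion of
`…LowerTailOddsBernstein` (THEOREM A′ for `γ ≥ 1 - θ₀`).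

* `hyp_ge_pow`, `hyp_le_pow_mul` — two-sided geometric bounds for the finite Gauss sums `H a c r = ₂F₁(a,-r;c;g)`:
  `(1-g)^r ≤ H a c r` for `a ≤ c`, and `H a c r ≤ (1-g)^r (1 - g(a-c) r/(c(1-g)))` for `c ≤ a ≤ c+1`;
* `hyp_neg_of_gt`, `hyp_ratio_neg_of_lt` — **sharpness**: for `θ ∈ (0,1)`, `0 < γ < 1-θ`, `0 < g < 1` the sequence
  `Q_{θ-1}(m) = ₂F₁(1-θ,-m;γ;g)` takes negative values, so `ρ = Q_{θ-1}/Q_θ` is not completely monotone; by the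
  equivalence THEOREM E of the memo (A′(θ,γ) ⟺ ρ CM) CONJECTURE A′ fails below the line `θ + γ = 1`;
* `lPlusC_div_factorial_tn_of_pureGrabber_odds` — the kernel statement in the exact W♯ form used for `F_s`: if
  `c_n > 0` has W♯ moment sequence `κ^r ∏_{m≤r} a_m/(a_m+λ)` (`a` = pure-grabber odds, `0 < κ ≤ 1` the dilation
  `1 - λ_A/λ_B`, `λ = 1/g_A > 0`), then `[(l+c_n)/(n-l)!]` is TN — THEOREM N TP_∞ for every `q_A` and every `p_A`
  whenever `γ = s+1 ≥ 1 - θ₀`.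
-/

namespace Summit.CriticalPhenomena.PercolationContinuityZ3.Theorems

namespace HypergeomCM

open Finset MomentRatioTN
open scoped Nat

section

variable (g : ℝ) (H : ℝ → ℝ → ℕ → ℝ)
  (hH : ∀ a c r, H a c r = ∑ k ∈ range (r + 1), (r.choose k : ℝ) * (-g) ^ k *
    ((∏ i ∈ range k, (a + i)) / (∏ i ∈ range k, (c + i))))
include hH

/-- Geometric lower bound: for `0 ≤ g < 1`, `c > 0`, `a ≤ c`: `H a c r ≥ (1-g)^r`
(from the positive recurrence `c H a c (r+1) = c(1-g) H a c r + g(c-a) H a (c+1) r` and `H a (c+1) r > 0`). -/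
theorem hyp_ge_pow (hg0 : 0 ≤ g) (hg1 : g < 1) (a : ℝ) :
    ∀ (r : ℕ) (c : ℝ), 0 < c → a ≤ c → (1 - g) ^ r ≤ H a c r := by
  intro r
  induction r with
  | zero => intro c _ _; rw [hyp_zero g H hH]; simp
  | succ r ih =>
    intro c hc hac
    have key := hyp_posrec g H hH a c hc r
    have h1 := ih c hc hac
    have h2 : 0 ≤ g * (c - a) * H a (c + 1) r :=
      mul_nonneg (mul_nonneg hg0 (by linarith)) (hyp_pos g H hH hg0 hg1 a r (c + 1) (by linarith) (by linarith)).le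
    have h3 : c * ((1 - g) ^ (r + 1)) ≤ c * H a c (r + 1) := by
      rw [key, pow_succ]
      nlinarith [mul_le_mul_of_nonneg_left h1 (mul_nonneg hc.le (sub_nonneg.2 hg1.le))]
    exact le_of_mul_le_mul_left h3 hc

/-- **Upper bound beyond the Beta range.**  For `0 ≤ g < 1`, `0 < c ≤ a ≤ c + 1`:
`H a c r ≤ (1-g)^r · (1 - g (a-c) r/(c (1-g)))`.  (The same recurrence, now with `c - a ≤ 0`, and `H a (c+1) r ≥ (1-g)^r`.) -/
theorem hyp_le_pow_mul (hg0 : 0 ≤ g) (hg1 : g < 1) (a c : ℝ) (hc : 0 < c) (hca : c ≤ a) (hac1 : a ≤ c + 1) :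
    ∀ r : ℕ, H a c r ≤ (1 - g) ^ r * (1 - g * (a - c) * r / (c * (1 - g))) := by
  have hh : 0 < 1 - g := sub_pos.2 hg1
  intro r
  induction r with
  | zero => rw [hyp_zero g H hH]; simp
  | succ r ih =>
    have key := hyp_posrec g H hH a c hc r
    have hlow := hyp_ge_pow g H hH hg0 hg1 a r (c + 1) (by linarith) hac1
    -- c H(r+1) = c h H(r) + g (c-a) H a (c+1) r ≤ c h · h^r (1 - g(a-c) r/(c h)) + g (c - a) h^r
    have h1 : c * (1 - g) * H a c r ≤ c * (1 - g) * ((1 - g) ^ r * (1 - g * (a - c) * r / (c * (1 - g)))) :=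
      mul_le_mul_of_nonneg_left ih (mul_nonneg hc.le hh.le)
    have h2 : g * (c - a) * H a (c + 1) r ≤ g * (c - a) * (1 - g) ^ r :=
      mul_le_mul_of_nonpos_left hlow (mul_nonpos_of_nonneg_of_nonpos hg0 (by linarith))
    have h3 : c * H a c (r + 1) ≤ c * ((1 - g) ^ (r + 1) * (1 - g * (a - c) * ((r + 1 : ℕ) : ℝ) / (c * (1 - g)))) := by
      rw [key]
      have hc0 := hc.ne'
      have hh0 := hh.ne'
      have e : c * (1 - g) * ((1 - g) ^ r * (1 - g * (a - c) * r / (c * (1 - g)))) + g * (c - a) * (1 - g) ^ r =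
          c * ((1 - g) ^ (r + 1) * (1 - g * (a - c) * ((r + 1 : ℕ) : ℝ) / (c * (1 - g)))) := by
        push_cast
        field_simp
        ring
      linarith [e]
    exact le_of_mul_le_mul_left h3 hc

/-- **Sharpness of the threshold** (memo §3): if `0 < g < 1` and `0 < c < a ≤ c + 1` then `H a c r < 0` for some `r`
(indeed for every `r > c(1-g)/(g(a-c))`).  At `a = 1 - θ`, `c = γ` this is the case `θ + γ < 1` of CONJECTURE A′:
`Q_{θ-1}(m) = ₂F₁(1-θ,-m;γ;g)` becomes negative, so `ρ = Q_{θ-1}/Q_θ` is NOT completely monotone. -/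
theorem hyp_neg_of_gt (hg0 : 0 < g) (hg1 : g < 1) (a c : ℝ) (hc : 0 < c) (hca : c < a) (hac1 : a ≤ c + 1) :
    ∃ r : ℕ, H a c r < 0 := by
  have hh : 0 < 1 - g := sub_pos.2 hg1
  obtain ⟨r, hr⟩ := exists_nat_gt (c * (1 - g) / (g * (a - c)))
  refine ⟨r, lt_of_le_of_lt (hyp_le_pow_mul g H hH hg0.le hg1 a c hc hca.le hac1 r) ?_⟩
  have hpos : 0 < g * (a - c) := mul_pos hg0 (by linarith)
  have h1 : 1 - g * (a - c) * r / (c * (1 - g)) < 0 := by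
    rw [div_lt_iff₀ hpos] at hr
    have : c * (1 - g) < g * (a - c) * r := by linarith
    rw [sub_neg, lt_div_iff₀ (mul_pos hc hh)]
    linarith
  exact mul_neg_of_pos_of_neg (pow_pos hh r) h1

/-- The ratio form: for `θ ∈ (0,1)`, `0 < γ < 1 - θ`, `0 < g < 1` there is an `m` with
`₂F₁(1-θ,-m;γ;g)/₂F₁(-θ,-m;γ;g) < 0`; in particular the ratio sequence is not completely monotone and (memo §1,
THEOREM E) CONJECTURE A′ fails — the hypothesis `θ + γ ≥ 1` (for `θ ≤ 1`) of `pureGrabber_oddsDiff_altSum_nonneg`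
is sharp. -/
theorem hyp_ratio_neg_of_lt (hg0 : 0 < g) (hg1 : g < 1) (θ γ : ℝ) (hθ0 : 0 < θ) (hγ : 0 < γ)
    (hγθ : θ + γ < 1) : ∃ m : ℕ, H (1 - θ) γ m / H (-θ) γ m < 0 := by
  obtain ⟨m, hm⟩ := hyp_neg_of_gt g H hH hg0 hg1 (1 - θ) γ hγ (by linarith) (by linarith)
  exact ⟨m, div_neg_of_neg_of_pos hm (hyp_pos g H hH hg0.le hg1 (-θ) m γ hγ (by linarith))⟩

end

/-- **THEOREM N TP_∞ for every `q_A`, W♯ form with dilation (memo §2).**  Let `θ = θ₀ + n` (`0 < θ₀ ≤ 1`),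
`γ > 0`, `γ ≥ 1 - θ₀`, `0 ≤ g < 1`, `0 < κ ≤ 1`, `λ > 0`, and let `a_m = m P(m-1)/(γ Q(m))` be the pure-grabber odds
(`P = ₂F₁(-θ,-·;γ+1;g)`, `Q = ₂F₁(-θ,-·;γ;g)`, finite sums).  If `c_n > 0` is any sequence whose W♯ moment sequence is
`r!/∏_{m≤r}(m + c_m) = κ^r ∏_{m≤r} a_m/(a_m + λ)` — by PROOF-THEOREM-H-g36 (1.3)/(6′.0) this is the case for the
smoothed `x`-Laplace kernel `M` of `F_s`, `Ψ = (1+p_A u+q_A v)(1+p_B u+q_B v)^θ`, with `κ = 1 - λ_A/λ_B`, `λ = 1/g_A`,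
`γ = s+1`, `g = g_B` — then `[(l + c_n)/(n-l)!]_{l ≤ n}` is totally nonnegative.  Hence `F_s` is TP_∞ for every
`q_A > p_A` whenever `s ≥ -θ₀`. -/
theorem lPlusC_div_factorial_tn_of_pureGrabber_odds (θ₀ : ℝ) (n : ℕ) (γ g κ lam : ℝ) (h0 : 0 < θ₀) (h1 : θ₀ ≤ 1)
    (hγ : 0 < γ) (hγ1 : 1 - θ₀ ≤ γ) (hg0 : 0 ≤ g) (hg1 : g < 1) (hκ0 : 0 < κ) (hκ1 : κ ≤ 1) (hlam : 0 < lam)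
    (c : ℕ → ℝ) (hc : ∀ n, 0 < c n)
    (hμ : ∀ r : ℕ, ((r ! : ℕ) : ℝ) / ∏ m ∈ range r, ((m : ℝ) + 1 + c (m + 1)) =
      κ ^ r * ∏ m ∈ range r,
        ((((m + 1 : ℕ) : ℝ)) *
            (∑ l ∈ range (m + 1), (m.choose l : ℝ) * (-g) ^ l *
              ((∏ i ∈ range l, (-(θ₀ + n) + i)) / (∏ i ∈ range l, (γ + 1 + i)))) /
          (γ * ∑ l ∈ range (m + 1 + 1), ((m + 1).choose l : ℝ) * (-g) ^ l *
              ((∏ i ∈ range l, (-(θ₀ + n) + i)) / (∏ i ∈ range l, (γ + i)))) /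
        ((((m + 1 : ℕ) : ℝ)) *
            (∑ l ∈ range (m + 1), (m.choose l : ℝ) * (-g) ^ l *
              ((∏ i ∈ range l, (-(θ₀ + n) + i)) / (∏ i ∈ range l, (γ + 1 + i)))) /
          (γ * ∑ l ∈ range (m + 1 + 1), ((m + 1).choose l : ℝ) * (-g) ^ l *
              ((∏ i ∈ range l, (-(θ₀ + n) + i)) / (∏ i ∈ range l, (γ + i)))) + lam)))
    {k : ℕ} (r c' : Fin k → ℕ) (hr : StrictMono r) (hc' : StrictMono c') :
    0 ≤ (Matrix.of fun i j =>
      if c' j ≤ r i then ((c' j : ℝ) + c (r i)) / ((r i - c' j)! : ℕ) else 0).det := by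
  set P : ℝ → ℝ → ℕ → ℝ := fun a c r => ∑ l ∈ range (r + 1), (r.choose l : ℝ) * (-g) ^ l *
    ((∏ m ∈ range l, (a + m)) / (∏ m ∈ range l, (c + m))) with hPdef
  have hP : ∀ a c r, P a c r = ∑ l ∈ range (r + 1), (r.choose l : ℝ) * (-g) ^ l *
    ((∏ m ∈ range l, (a + m)) / (∏ m ∈ range l, (c + m))) := fun _ _ _ => rfl
  have hθ : (0 : ℝ) ≤ θ₀ + n := by positivity
  have hQpos : ∀ m, 0 < P (-(θ₀ + n)) γ m := fun m => hyp_pos g P hP hg0 hg1 (-(θ₀ + n)) m γ hγ (by linarith)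
  have hPpos : ∀ m, 0 < P (-(θ₀ + n)) (γ + 1) m :=
    fun m => hyp_pos g P hP hg0 hg1 (-(θ₀ + n)) m (γ + 1) (by linarith) (by linarith)
  -- the odds a_m = m P(m-1)/(γ Q(m)) as a sequence on ℕ
  set a : ℕ → ℝ := fun m => ((m : ℕ) : ℝ) * P (-(θ₀ + n)) (γ + 1) (m - 1) / (γ * P (-(θ₀ + n)) γ m) with hadef
  have ha : ∀ m, 0 < a (m + 1) := fun m => by
    simp only [hadef, Nat.add_sub_cancel]
    exact div_pos (mul_pos (by positivity) (hPpos m)) (mul_pos hγ (hQpos (m + 1)))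
  have hΔ : ∀ k j, 0 ≤ ∑ i ∈ range (k + 1), (-1 : ℝ) ^ i * (k.choose i : ℝ) * (a (j + i + 1 + 1) - a (j + i + 1)) := by
    intro k j
    have := pureGrabber_oddsDiff_altSum_nonneg g P hP hg0 hg1 θ₀ h0 h1 n γ hγ hγ1 k (j + 1)
    refine le_of_le_of_eq this (sum_congr rfl fun i _ => ?_)
    simp only [hadef, show j + 1 + i = j + i + 1 by ring]
  refine MomentRatioTN.lPlusC_div_factorial_tn c hc (fun k j => ?_) r c' hr hc'
  have hμ' : ∀ r : ℕ, ((r ! : ℕ) : ℝ) / ∏ m ∈ range r, ((m : ℝ) + 1 + c (m + 1)) =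
      κ ^ r * ∏ m ∈ range r, (a (m + 1) / (a (m + 1) + lam)) := by
    intro r
    rw [hμ r]
    simp only [hadef, hPdef, Nat.add_sub_cancel]
  simp only [hμ']
  exact altSum_mul_pos_of_pos (fun r => κ ^ r) (fun r => ∏ m ∈ range r, (a (m + 1) / (a (m + 1) + lam)))
    (fun r => pow_pos hκ0 r) (altSum_geom_nonneg κ hκ0.le hκ1)
    (altSum_prod_scaling_pos a ha hΔ lam hlam) k j

end HypergeomCM

end Summit.CriticalPhenomena.PercolationContinuityZ3.Theorems
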